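import Summits.NavierStokesRegularity.NavierStokesRegularity.Theorems.QuantisedSymmetryQuantisedOrderRotation
import Literature.Analysis.FluidPDE.AxisymmetricSingularSetOnAxis
import Literature.Analysis.FluidPDE.PineauVicolAngularMean
import Literature.Analysis.FluidPDE.AxisymHouLiVariables
import HarnessLib

/-!
# Route QuantisedSymmetry, item `QuantisedOrder` (stmt-NavierStokesRegularity-11293) — II:
# an `L³(Q(0, R))` limit of `C_{n_j}`-equivariant fields, `n_j → ∞`, is a.e. axisymmetric

**Proposition.** Let `0 < R ≤ 1`, `Q = Q(0, R) = ]-R², 0[ × B_R(0)`, and let `w_j → u` in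
`L³(Q)`, where each slice `w_j(t, ·)`, `-1 < t < 0`, is equivariant under the rotation `R_{2π/n_j}`
about the `x₃`-axis and `n_j → ∞`.  Then for EVERY angle `θ`, `u(t, R_θ x) = R_θ u(t, x)` for
a.e. `(t, x) ∈ Q`.

*Proof.* For a continuous compactly supported scalar test function `g` put
`B(v, θ) = ∫_Q g · (v ∘ (id × R_θ) - R_θ v)`.  (1) `B(w_j, 2πm/n_j)` has vanishing integrand on `Q`.
(2) `θ ↦ B(u, θ)` is continuous (the change of variables `x ↦ R_{-θ} x` moves the rotation onto the
test function; dominated convergence).  (3) `‖B(v, θ)‖ ≤ 2 sup|g| ‖v‖_{L¹(Q)}` uniformly in `θ`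
(rotation invariance of the measure), applied to `v = w_j - u`, whose integrand agrees on `Q` with
minus that of `B(u, 2πm/n_j)` by (1).  (4) For `θ ≥ 0` the lattice angles
`θ_j = 2π⌊θ n_j/2π⌋/n_j → θ`, so `B(u, θ) = lim B(u, θ_j) = 0`; negative angles by
`2π`-periodicity.  (5) A locally integrable function all of whose integrals against smooth
compactly supported test functions on the open set `Q` vanish is a.e. zero there.

Measure theory only (the density of the angles `2πm/n_j` replaces the `L³`-continuity of the
rotation group); nothing here is specific to the Navier–Stokes equations.

## References

* G. Seregin, V. Šverák, Comm. PDE 34 (2009) = arXiv:0804.1803, §3. [SereginSverak2009]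
-/

set_option linter.dupNamespace false

noncomputable section

open MeasureTheory Set Function Filter Topology Metric
open scoped ENNReal NNReal

namespace Summit.NavierStokesRegularity.NavierStokesRegularity.Theorems.QuantisedOrder

open Literature.Analysis.FluidPDE

/-! ### Elementary facts about the rotations -/

/-- `2π`-periodicity of the rotations: `R_{θ + 2πk} = R_θ`, `k ∈ ℕ`. [folklore] -/
theorem rotZ_add_nat_mul_two_pi (θ : ℝ) (k : ℕ) (x : EuclideanSpace ℝ (Fin 3)) :
    rotZ (θ + k * (2 * Real.pi)) x = rotZ θ x := by
  induction k with
  | zero => simp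
  | succ k ih =>
      have e : θ + ((k + 1 : ℕ) : ℝ) * (2 * Real.pi) = (θ + k * (2 * Real.pi)) + 2 * Real.pi := by
        push_cast; ring
      rw [e, rotZ_add_two_pi, ih]

/-- Every angle is congruent modulo `2πℕ` to a nonnegative one: `R_θ = R_{θ'}` with `θ' ≥ 0`.
[folklore] -/
theorem exists_nonneg_rotZ_eq (θ : ℝ) :
    ∃ θ' : ℝ, 0 ≤ θ' ∧ ∀ x : EuclideanSpace ℝ (Fin 3), rotZ θ x = rotZ θ' x := by
  obtain ⟨k, hk⟩ := exists_nat_ge (-θ / (2 * Real.pi))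
  refine ⟨θ + k * (2 * Real.pi), ?_, fun x => (rotZ_add_nat_mul_two_pi θ k x).symm⟩
  have hπ : 0 < 2 * Real.pi := by positivity
  rw [div_le_iff₀ hπ] at hk
  linarith

/-- The lattice angles `2π⌊θ n_j/(2π)⌋/n_j` converge to `θ ≥ 0` when `n_j → ∞`. [folklore] -/
theorem tendsto_latticeAngle {θ : ℝ} (hθ : 0 ≤ θ) {n : ℕ → ℕ} (hn0 : ∀ j, 0 < n j)
    (hn : Tendsto (fun j => (n j : ℝ)) atTop atTop) :
    Tendsto (fun j => (⌊θ * n j / (2 * Real.pi)⌋₊ : ℝ) * (2 * Real.pi / n j)) atTop (𝓝 θ) := by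
  rw [tendsto_iff_norm_sub_tendsto_zero]
  have h0 : Tendsto (fun j => 2 * Real.pi / (n j : ℝ)) atTop (𝓝 0) :=
    tendsto_const_nhds.div_atTop hn
  refine squeeze_zero (fun j => norm_nonneg _) (fun j => ?_) h0
  rw [Real.norm_eq_abs]
  exact abs_latticeAngle_sub_le hθ (hn0 j)

/-- A slice-wise `R_α`-equivariant field on `]-1, 0[` has vanishing rotation defect
`v(t, R_{mα} x) - R_{mα} v(t, x)` at every point of `Q(0, R)`, `R ≤ 1`. [folklore] -/
theorem rotDiff_eq_zero_of_equivariant {R : ℝ} (hR1 : R ≤ 1)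
    {v : ℝ → EuclideanSpace ℝ (Fin 3) → EuclideanSpace ℝ (Fin 3)} {α : ℝ}
    (hv : ∀ t ∈ Ioo (-1 : ℝ) 0, ∀ x, v t (rotZ α x) = rotZ α (v t x)) (m : ℕ)
    {z : ℝ × EuclideanSpace ℝ (Fin 3)} (hz : z ∈ parabolicCylinder R (0 : ℝ × EuclideanSpace ℝ (Fin 3))) :
    v z.1 (rotZ ((m : ℝ) * α) z.2) - rotZ ((m : ℝ) * α) (v z.1 z.2) = 0 := by
  rw [SuitableCompactness.mem_parabolicCylinder_zero] at hz
  have hR0 : 0 < R := (norm_nonneg _).trans_lt hz.2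
  have hR2 : R ^ 2 ≤ 1 := pow_le_one₀ hR0.le hR1
  have ht : z.1 ∈ Ioo (-1 : ℝ) 0 := ⟨by linarith [hz.1.1], hz.1.2⟩
  rw [sub_eq_zero]
  exact equivariant_natMul (hv z.1 ht) m z.2

/-- Pointwise bookkeeping: if `W' = R_θ W` then
`g • (U' - R_θ U) = -(g • ((W' - U') - R_θ (W - U)))`. [folklore] -/
theorem smul_rotDiff_eq_neg (g : ℝ) {θ : ℝ} {W W' U U' : EuclideanSpace ℝ (Fin 3)}
    (h0 : W' = rotZ θ W) :
    g • (U' - rotZ θ U) = -(g • ((W' - U') - rotZ θ (W - U))) := by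
  have e2 : rotZ θ (W - U) = rotZ θ W - rotZ θ U := map_sub (rotZL θ) W U
  rw [e2, h0]
  have e3 : rotZ θ W - U' - (rotZ θ W - rotZ θ U) = -(U' - rotZ θ U) := by abel
  rw [e3, smul_neg, neg_neg]

/-! ### The functional `B(v, θ) = ∫_Q g · (v ∘ (id × R_θ) - R_θ v)` -/

/-- **Uniform bound**: `‖∫_Q g · (v ∘ (id × R_θ) - R_θ v)‖ ≤ 2 sup|g| · ‖v‖_{L¹(Q)}` (in `ℝ≥0∞`),
by the rotation invariance of the measure on `Q(0, R)`. [folklore] -/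
theorem enorm_setIntegral_smul_rotDiff_le (θ R : ℝ) {g : ℝ × EuclideanSpace ℝ (Fin 3) → ℝ} {S : ℝ}
    (hS : ∀ z, ‖g z‖ ≤ S) {v : ℝ × EuclideanSpace ℝ (Fin 3) → EuclideanSpace ℝ (Fin 3)}
    (hv : AEStronglyMeasurable v
      ((volume : Measure (ℝ × EuclideanSpace ℝ (Fin 3))).restrict
        (parabolicCylinder R (0 : ℝ × EuclideanSpace ℝ (Fin 3))))) :
    ‖∫ z in parabolicCylinder R (0 : ℝ × EuclideanSpace ℝ (Fin 3)),
        g z • (v (z.1, rotZ θ z.2) - rotZ θ (v z))‖ₑ ≤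
      ENNReal.ofReal S *
        (2 * ∫⁻ z in parabolicCylinder R (0 : ℝ × EuclideanSpace ℝ (Fin 3)), ‖v z‖ₑ) := by
  have hS0 : 0 ≤ S := (norm_nonneg _).trans (hS 0)
  refine (enorm_integral_le_lintegral_enorm _).trans ?_
  have hpt : ∀ z : ℝ × EuclideanSpace ℝ (Fin 3),
      ‖g z • (v (z.1, rotZ θ z.2) - rotZ θ (v z))‖ₑ ≤
        ENNReal.ofReal S * (‖v (z.1, rotZ θ z.2)‖ₑ + ‖v z‖ₑ) := by
    intro z
    rw [enorm_smul]
    refine mul_le_mul' ?_ ?_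
    · rw [← ofReal_norm]
      exact ENNReal.ofReal_le_ofReal (hS z)
    · refine enorm_sub_le.trans ?_
      rw [← ofReal_norm (rotZ θ (v z)), norm_rotZ, ofReal_norm]
  have hmeas : AEMeasurable (fun z : ℝ × EuclideanSpace ℝ (Fin 3) => ‖v (z.1, rotZ θ z.2)‖ₑ)
      ((volume : Measure (ℝ × EuclideanSpace ℝ (Fin 3))).restrict
        (parabolicCylinder R (0 : ℝ × EuclideanSpace ℝ (Fin 3)))) :=
    (aestronglyMeasurable_comp_prodMap_rotZ θ R hv).enorm
  calc ∫⁻ z in parabolicCylinder R (0 : ℝ × EuclideanSpace ℝ (Fin 3)),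
        ‖g z • (v (z.1, rotZ θ z.2) - rotZ θ (v z))‖ₑ
      ≤ ∫⁻ z in parabolicCylinder R (0 : ℝ × EuclideanSpace ℝ (Fin 3)),
          ENNReal.ofReal S * (‖v (z.1, rotZ θ z.2)‖ₑ + ‖v z‖ₑ) := lintegral_mono hpt
    _ = ENNReal.ofReal S * ((∫⁻ z in parabolicCylinder R (0 : ℝ × EuclideanSpace ℝ (Fin 3)),
          ‖v (z.1, rotZ θ z.2)‖ₑ) +
          ∫⁻ z in parabolicCylinder R (0 : ℝ × EuclideanSpace ℝ (Fin 3)), ‖v z‖ₑ) := by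
        rw [lintegral_const_mul' _ _ ENNReal.ofReal_ne_top, lintegral_add_left' hmeas]
    _ = ENNReal.ofReal S *
          (2 * ∫⁻ z in parabolicCylinder R (0 : ℝ × EuclideanSpace ℝ (Fin 3)), ‖v z‖ₑ) := by
        rw [setLIntegral_comp_prodMap_rotZ θ R (fun z => ‖v z‖ₑ), two_mul]

/-- **Continuity in the angle**: for `g` continuous and bounded and `v ∈ L¹(Q(0, R))`,
`θ ↦ ∫_Q g · (v ∘ (id × R_θ) - R_θ v)` is continuous (the substitution `x ↦ R_{-θ} x` moves the
rotation onto `g`; dominated convergence). [folklore] -/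
theorem continuous_setIntegral_smul_rotDiff (R : ℝ) {g : ℝ × EuclideanSpace ℝ (Fin 3) → ℝ}
    (hg : Continuous g) {S : ℝ} (hS : ∀ z, ‖g z‖ ≤ S)
    {v : ℝ × EuclideanSpace ℝ (Fin 3) → EuclideanSpace ℝ (Fin 3)}
    (hv : Integrable v ((volume : Measure (ℝ × EuclideanSpace ℝ (Fin 3))).restrict
        (parabolicCylinder R (0 : ℝ × EuclideanSpace ℝ (Fin 3))))) :
    Continuous fun θ : ℝ => ∫ z in parabolicCylinder R (0 : ℝ × EuclideanSpace ℝ (Fin 3)),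
      g z • (v (z.1, rotZ θ z.2) - rotZ θ (v z)) := by
  set μQ := (volume : Measure (ℝ × EuclideanSpace ℝ (Fin 3))).restrict
    (parabolicCylinder R (0 : ℝ × EuclideanSpace ℝ (Fin 3))) with hμQ
  have hvm : AEStronglyMeasurable v μQ := hv.aestronglyMeasurable
  -- boundedness of the (rotated) test functions
  have hgm : ∀ θ : ℝ, MemLp (fun z : ℝ × EuclideanSpace ℝ (Fin 3) => g (z.1, rotZ θ z.2)) ∞ μQ := by
    intro θ
    refine memLp_top_of_bound ?_ S (Eventually.of_forall fun z => hS _)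
    exact (hg.comp (continuous_fst.prodMk ((rotZL θ).continuous.comp continuous_snd))).aestronglyMeasurable
  have hg0 : MemLp g ∞ μQ := by
    have := hgm 0
    simpa only [rotZ_zero, Prod.mk.eta] using this
  -- integrability of the two halves of the integrand
  have h1 : ∀ θ : ℝ, Integrable (fun z : ℝ × EuclideanSpace ℝ (Fin 3) => g z • v (z.1, rotZ θ z.2)) μQ := by
    intro θ
    have hi : Integrable (fun z : ℝ × EuclideanSpace ℝ (Fin 3) => v (z.1, rotZ θ z.2)) μQ :=
      ((measurePreserving_prodMap_rotZ_restrict θ R).integrable_comp_emb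
        (measurableEmbedding_prodMap_rotZ θ)).2 hv
    exact hi.smul_of_top_right hg0
  have h2 : ∀ θ : ℝ, Integrable (fun z : ℝ × EuclideanSpace ℝ (Fin 3) => g z • rotZ θ (v z)) μQ := by
    intro θ
    have e : (fun z : ℝ × EuclideanSpace ℝ (Fin 3) => g z • rotZ θ (v z)) =
        fun z => rotZL θ (g z • v z) := by
      funext z; rw [map_smul, rotZL_apply]
    rw [e]
    exact ContinuousLinearMap.integrable_comp _ (hv.smul_of_top_right hg0)
  -- moving the rotation onto the test function
  have e : (fun θ : ℝ => ∫ z in parabolicCylinder R (0 : ℝ × EuclideanSpace ℝ (Fin 3)),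
        g z • (v (z.1, rotZ θ z.2) - rotZ θ (v z))) =
      fun θ => (∫ z in parabolicCylinder R (0 : ℝ × EuclideanSpace ℝ (Fin 3)),
          g (z.1, rotZ (-θ) z.2) • v z) -
        rotZL θ (∫ z in parabolicCylinder R (0 : ℝ × EuclideanSpace ℝ (Fin 3)), g z • v z) := by
    funext θ
    simp only [smul_sub]
    rw [integral_sub (h1 θ) (h2 θ)]
    congr 1
    · rw [← setIntegral_comp_prodMap_rotZ θ R (fun z => g (z.1, rotZ (-θ) z.2) • v z)]
      simp only [rotZ_neg_apply_rotZ, Prod.mk.eta]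
      rfl
    · have hi : Integrable (fun z : ℝ × EuclideanSpace ℝ (Fin 3) => g z • v z) μQ :=
        hv.smul_of_top_right hg0
      rw [← (rotZL θ).integral_comp_comm hi]
      simp only [map_smul, rotZL_apply]
  rw [e]
  refine Continuous.sub ?_ ?_
  · refine continuous_of_dominated (F := fun (θ : ℝ) (z : ℝ × EuclideanSpace ℝ (Fin 3)) =>
        g (z.1, rotZ (-θ) z.2) • v z) (bound := fun z => S * ‖v z‖) ?_ ?_ ?_ ?_
    · intro θ
      exact (hgm (-θ)).1.smul hvm
    · intro θ
      refine Eventually.of_forall fun z => ?_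
      rw [norm_smul]
      exact mul_le_mul_of_nonneg_right (hS _) (norm_nonneg _)
    · exact hv.norm.const_mul S
    · refine Eventually.of_forall fun z => ?_
      exact ((hg.comp (continuous_const.prodMk ((continuous_rotZ_angle z.2).comp
        continuous_neg))).smul continuous_const)
  · exact continuous_rotZ_angle _

/-! ### The limit is a.e. equivariant under every rotation -/

/-- **An `L³(Q(0, R))` limit of slice-wise `C_{n_j}`-equivariant fields with `n_j → ∞` is a.e.
equivariant under `R_θ` for every `θ ≥ 0`.** [folklore] -/
theorem ae_equivariant_of_tendsto_of_nonneg {R : ℝ} (hR1 : R ≤ 1)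
    {w : ℕ → ℝ → EuclideanSpace ℝ (Fin 3) → EuclideanSpace ℝ (Fin 3)}
    {u : ℝ → EuclideanSpace ℝ (Fin 3) → EuclideanSpace ℝ (Fin 3)} {n : ℕ → ℕ}
    (hn0 : ∀ j, 0 < n j) (hn : Tendsto (fun j => (n j : ℝ)) atTop atTop)
    (hsym : ∀ j, ∀ t ∈ Ioo (-1 : ℝ) 0, ∀ x,
      w j t (rotZ (2 * Real.pi / n j) x) = rotZ (2 * Real.pi / n j) (w j t x))
    (hwm : ∀ j, AEStronglyMeasurable (uncurry (w j))
      ((volume : Measure (ℝ × EuclideanSpace ℝ (Fin 3))).restrict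
        (parabolicCylinder R (0 : ℝ × EuclideanSpace ℝ (Fin 3)))))
    (hu : MemLp (uncurry u) 3
      ((volume : Measure (ℝ × EuclideanSpace ℝ (Fin 3))).restrict
        (parabolicCylinder R (0 : ℝ × EuclideanSpace ℝ (Fin 3)))))
    (hconv : Tendsto (fun j => eLpNorm (uncurry (w j) - uncurry u) 3
      ((volume : Measure (ℝ × EuclideanSpace ℝ (Fin 3))).restrict
        (parabolicCylinder R (0 : ℝ × EuclideanSpace ℝ (Fin 3))))) atTop (𝓝 0))
    {θ : ℝ} (hθ : 0 ≤ θ) :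
    ∀ᵐ z ∂((volume : Measure (ℝ × EuclideanSpace ℝ (Fin 3))).restrict
        (parabolicCylinder R (0 : ℝ × EuclideanSpace ℝ (Fin 3)))),
      u z.1 (rotZ θ z.2) = rotZ θ (u z.1 z.2) := by
  set Q := parabolicCylinder R (0 : ℝ × EuclideanSpace ℝ (Fin 3)) with hQ
  set μQ := (volume : Measure (ℝ × EuclideanSpace ℝ (Fin 3))).restrict Q with hμQ
  haveI : IsFiniteMeasure μQ := SuitableCompactness.isFiniteMeasure_restrict_parabolicCylinder_zero R
  have hQm : MeasurableSet Q := (isOpen_parabolicCylinder R _).measurableSet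
  have hum : AEStronglyMeasurable (uncurry u) μQ := hu.aestronglyMeasurable
  have hu1 : Integrable (uncurry u) μQ := hu.integrable (by norm_num)
  -- `L¹` smallness of `w_j - u`
  set δ : ℕ → ℝ≥0∞ := fun j => ∫⁻ z in Q, ‖(uncurry (w j) - uncurry u) z‖ₑ with hδ
  have hδ0 : Tendsto δ atTop (𝓝 0) := by
    have hle : ∀ j, δ j ≤ eLpNorm (uncurry (w j) - uncurry u) 3 μQ *
        μQ univ ^ (1 / (1 : ℝ≥0∞).toReal - 1 / (3 : ℝ≥0∞).toReal) := by
      intro j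
      rw [hδ]
      dsimp only
      rw [← eLpNorm_one_eq_lintegral_enorm]
      exact eLpNorm_le_eLpNorm_mul_rpow_measure_univ (by norm_num) ((hwm j).sub hum)
    have hfin : μQ univ ^ (1 / (1 : ℝ≥0∞).toReal - 1 / (3 : ℝ≥0∞).toReal) ≠ ⊤ :=
      ENNReal.rpow_ne_top_of_nonneg (by norm_num) (measure_ne_top μQ _)
    have hlim := ENNReal.Tendsto.mul_const hconv (Or.inr hfin)
    rw [zero_mul] at hlim
    exact tendsto_of_tendsto_of_tendsto_of_le_of_le tendsto_const_nhds hlim (fun _ => bot_le) hle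
  -- the rotation defect of `u`
  set f : ℝ × EuclideanSpace ℝ (Fin 3) → EuclideanSpace ℝ (Fin 3) :=
    fun z => u z.1 (rotZ θ z.2) - rotZ θ (u z.1 z.2) with hf
  have hfi : Integrable f μQ := by
    have hi : Integrable (fun z : ℝ × EuclideanSpace ℝ (Fin 3) => uncurry u (z.1, rotZ θ z.2)) μQ :=
      ((measurePreserving_prodMap_rotZ_restrict θ R).integrable_comp_emb
        (measurableEmbedding_prodMap_rotZ θ)).2 hu1
    exact hi.sub (ContinuousLinearMap.integrable_comp (rotZL θ) hu1)
  have hfl : LocallyIntegrableOn f Q μQ := hfi.locallyIntegrable.locallyIntegrableOn Q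
  -- all test integrals vanish
  have H : ∀ g : ℝ × EuclideanSpace ℝ (Fin 3) → ℝ, ContDiff ℝ (⊤ : ℕ∞) g → HasCompactSupport g →
      tsupport g ⊆ Q → ∫ z, g z • f z ∂μQ = 0 := by
    intro g hg hgc _
    obtain ⟨S, hS⟩ := hgc.exists_bound_of_continuous hg.continuous
    set ϑ : ℕ → ℝ := fun j => (⌊θ * n j / (2 * Real.pi)⌋₊ : ℝ) * (2 * Real.pi / n j) with hϑ
    have hϑθ : Tendsto ϑ atTop (𝓝 θ) := tendsto_latticeAngle hθ hn0 hn
    set B : ℝ → EuclideanSpace ℝ (Fin 3) := fun θ' => ∫ z in Q,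
      g z • (u z.1 (rotZ θ' z.2) - rotZ θ' (u z.1 z.2)) with hB
    have hcont : Continuous B := continuous_setIntegral_smul_rotDiff R hg.continuous hS hu1
    have hlim1 : Tendsto (fun j => B (ϑ j)) atTop (𝓝 (B θ)) := (hcont.tendsto θ).comp hϑθ
    -- `B(ϑ_j) = -B_{w_j - u}(ϑ_j)` pointwise on `Q`
    have heq : ∀ j, B (ϑ j) = -∫ z in Q, g z • ((uncurry (w j) - uncurry u) (z.1, rotZ (ϑ j) z.2) -
        rotZ (ϑ j) ((uncurry (w j) - uncurry u) z)) := by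
      intro j
      rw [hB, ← integral_neg]
      refine setIntegral_congr_fun hQm fun z hz => ?_
      have h0 := rotDiff_eq_zero_of_equivariant hR1 (hsym j) ⌊θ * n j / (2 * Real.pi)⌋₊ hz
      rw [sub_eq_zero] at h0
      exact smul_rotDiff_eq_neg (g z) h0
    -- hence `‖B(ϑ_j)‖ ≤ 2 S δ_j → 0`
    have hbd : ∀ j, ‖B (ϑ j)‖ₑ ≤ ENNReal.ofReal S * (2 * δ j) := by
      intro j
      rw [heq j, enorm_neg]
      exact enorm_setIntegral_smul_rotDiff_le (ϑ j) R hS ((hwm j).sub hum)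
    have hlim0 : Tendsto (fun j => ENNReal.ofReal S * (2 * δ j)) atTop (𝓝 0) := by
      have h2 : Tendsto (fun j => 2 * δ j) atTop (𝓝 (2 * 0)) :=
        ENNReal.Tendsto.const_mul hδ0 (Or.inr ENNReal.ofNat_ne_top)
      have h3 := ENNReal.Tendsto.const_mul h2 (Or.inr (ENNReal.ofReal_ne_top (r := S)))
      simpa using h3
    have hlimE : Tendsto (fun j => ‖B (ϑ j)‖ₑ) atTop (𝓝 0) :=
      tendsto_of_tendsto_of_tendsto_of_le_of_le tendsto_const_nhds hlim0 (fun _ => bot_le) hbd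
    have hlim2 : Tendsto (fun j => B (ϑ j)) atTop (𝓝 0) := by
      rw [tendsto_zero_iff_norm_tendsto_zero]
      have h4 : Tendsto (fun j => ‖B (ϑ j)‖₊) atTop (𝓝 0) := by
        rw [← ENNReal.tendsto_coe]
        simpa [enorm] using hlimE
      simpa using NNReal.tendsto_coe.2 h4
    have hB0 : B θ = 0 := tendsto_nhds_unique hlim1 hlim2
    rw [hμQ, hf]
    exact hB0
  have hae := (isOpen_parabolicCylinder R (0 : ℝ × EuclideanSpace ℝ (Fin 3))).ae_eq_zero_of_integral_contDiff_smul_eq_zero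
    hfl H
  filter_upwards [hae, ae_restrict_mem hQm] with z hz hzQ
  exact sub_eq_zero.1 (hz hzQ)

/-- **An `L³(Q(0, R))` limit of slice-wise `C_{n_j}`-equivariant fields with `n_j → ∞` is a.e.
equivariant under every rotation `R_θ` about the axis.** [folklore] -/
theorem ae_equivariant_of_tendsto {R : ℝ} (hR1 : R ≤ 1)
    {w : ℕ → ℝ → EuclideanSpace ℝ (Fin 3) → EuclideanSpace ℝ (Fin 3)}
    {u : ℝ → EuclideanSpace ℝ (Fin 3) → EuclideanSpace ℝ (Fin 3)} {n : ℕ → ℕ}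
    (hn0 : ∀ j, 0 < n j) (hn : Tendsto (fun j => (n j : ℝ)) atTop atTop)
    (hsym : ∀ j, ∀ t ∈ Ioo (-1 : ℝ) 0, ∀ x,
      w j t (rotZ (2 * Real.pi / n j) x) = rotZ (2 * Real.pi / n j) (w j t x))
    (hwm : ∀ j, AEStronglyMeasurable (uncurry (w j))
      ((volume : Measure (ℝ × EuclideanSpace ℝ (Fin 3))).restrict
        (parabolicCylinder R (0 : ℝ × EuclideanSpace ℝ (Fin 3)))))
    (hu : MemLp (uncurry u) 3
      ((volume : Measure (ℝ × EuclideanSpace ℝ (Fin 3))).restrict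
        (parabolicCylinder R (0 : ℝ × EuclideanSpace ℝ (Fin 3)))))
    (hconv : Tendsto (fun j => eLpNorm (uncurry (w j) - uncurry u) 3
      ((volume : Measure (ℝ × EuclideanSpace ℝ (Fin 3))).restrict
        (parabolicCylinder R (0 : ℝ × EuclideanSpace ℝ (Fin 3))))) atTop (𝓝 0))
    (θ : ℝ) :
    ∀ᵐ z ∂((volume : Measure (ℝ × EuclideanSpace ℝ (Fin 3))).restrict
        (parabolicCylinder R (0 : ℝ × EuclideanSpace ℝ (Fin 3)))),
      u z.1 (rotZ θ z.2) = rotZ θ (u z.1 z.2) := by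
  obtain ⟨θ', hθ', hθθ'⟩ := exists_nonneg_rotZ_eq θ
  simp only [hθθ']
  exact ae_equivariant_of_tendsto_of_nonneg hR1 hn0 hn hsym hwm hu hconv hθ'

end Summit.NavierStokesRegularity.NavierStokesRegularity.Theorems.QuantisedOrder

end
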